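import Mathlib.LinearAlgebra.Matrix.Block
import Mathlib.Data.Matrix.Block
import Mathlib.LinearAlgebra.Matrix.GeneralLinearGroup.Defs
import Mathlib.LinearAlgebra.Matrix.Reindex
import Mathlib.Algebra.Group.Pi.Units
import Mathlib.Logic.Equiv.Sum
import Mathlib.GroupTheory.Complement
import Mathlib.RingTheory.FiniteLength
import Mathlib.RepresentationTheory.Coinvariants
import Mathlib.Topology.Instances.Matrix
import Literature.NumberTheory.Automorphic.SmoothInduction
import Literature.NumberTheory.Automorphic.JacquetModule
import Literature.NumberTheory.Automorphic.SmoothRepresentation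
import Literature.NumberTheory.Automorphic.MatrixCoefficients
import Literature.NumberTheory.GaloisRepresentations.LocalField
import HarnessLib

-- provenance: harness21/H21/H21/Prelude/AutomorphicL/ParabolicGL.lean @ 33cdf37 (interim HEAD d8f2665); M5 mechanical rewrite
/-!
# Standard parabolic subgroups of `GL_n`, parabolic induction and Jacquet functors
(AutomorphicL trunk, item I7 = `G25:ParabolicGL`; notion `parabolic_induction_jacquet`)

Let `R` be a commutative ring, `n` a finite index type and `c : n → α` a map to a linear order
(the model is `c : Fin n → Fin r` monotone, an ordered partition `n = n₁ + ⋯ + n_r`). The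
**standard parabolic subgroup** `P_c ≤ GL_n(R)` attached to `c` is the group of invertible
matrices `g` which are block upper triangular with respect to `c` (`g i j = 0` whenever
`c j < c i`, Mathlib's `Matrix.BlockTriangular`). Its **standard Levi factor** is the group of
block diagonal matrices `M_c ≅ Π_a GL_{n_a}(R)` and its **unipotent radical** `U_c` consists of
the block upper triangular matrices with identity diagonal blocks; `P_c = M_c ⋉ U_c`
(Bernstein–Zelevinsky 1977, §2.1; Zelevinsky 1980, §1.1). This file provides

* `Literature.NumberTheory.Automorphic.standardParabolicGL R c : Subgroup (GL n R)` and `Literature.NumberTheory.Automorphic.mem_standardParabolicGL_iff`;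
* the Levi projection `Literature.NumberTheory.Automorphic.leviProjection R c : ↥P_c →* Π a, GL {i // c i = a} R` ("take the
  diagonal blocks", a group homomorphism because block triangular matrices multiply blockwise
  on the diagonal, `Matrix.BlockTriangular.toSquareBlock_mul`) and the Levi embedding
  `Literature.NumberTheory.Automorphic.leviEmbeddingP R c : (Π a, GL {i // c i = a} R) →* ↥P_c` (block diagonal matrices), with
  the section identity `Literature.NumberTheory.Automorphic.leviProjection_leviEmbeddingP`;
* **the unipotent radical as a kernel**: `Literature.NumberTheory.Automorphic.unipotentRadicalP R c := (leviProjection R c).ker`,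
  a normal subgroup of `↥P_c` *by Mathlib's instance* `MonoidHom.normal_ker`, its image
  `Literature.NumberTheory.Automorphic.unipotentRadicalGL R c ≤ GL n R` (`mem_unipotentRadicalGL_iff`: block triangular with
  identity diagonal blocks), the standard Levi `Literature.NumberTheory.Automorphic.standardLeviGL R c`, the upper unitriangular
  group
  `Literature.NumberTheory.Automorphic.upperUnitriangular n R` (`c = id`), and the *predicate* `Literature.NumberTheory.Automorphic.IsProperBlocks c`
  (proper block labellings: `c` surjective and at least two blocks) with its characterisation
  `isProperBlocks_iff_ne_top` (`↔ P_c ≠ GL_n(R)` and all blocks non-empty, `R` nontrivial) and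
  `not_isProperBlocks_of_subsingleton` (no proper parabolics in `GL_0`, `GL_1`);
* the compatibility object `Literature.NumberTheory.Automorphic.parabolicTripleGL R c : ParabolicTriple (GL n R)` (item I6), all
  fields proved;
* the `GL_n` functors: normalised parabolic induction `Representation.parabolicIndGL F c σ`
  (`i_{P_c} σ = Ind (σ ∘ proj ⊗ δ^{1/2})`), the Jacquet functor `Representation.jacquetGL R c π`
  (`U_c`-coinvariants with the action of `Π_a GL_{n_a}` through the Levi embedding; definable with
  no group-theoretic proof thanks to the kernel design) and its normalised version
  `Representation.normalizedJacquetGL F c π` (twist by `δ^{-1/2}`);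
* `jacquetGLEquiv` / `jacquetGL_equiv_jacquetModule` (agreement with the abstract Jacquet module
  of I6 on `parabolicTripleGL R c`; proved), and the named facts (theorems with deferred proofs)
  `isAdmissible_parabolicIndGL`, `isAdmissible_jacquetGL` (Jacquet's lemma for `GL_n`; statement
  repaired 2026-08-15, see its docstring), `isFiniteLength_parabolicIndGL`
  (Bernstein–Zelevinsky 1977, §2; Zelevinsky 1980, §1).

## Mathlib declarations used rather than redefined

`Matrix.BlockTriangular` (with `BlockTriangular.mul`, `blockTriangular_one`,
`blockTriangular_inv_of_blockTriangular`; Mathlib also has the *subring*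
`Matrix.blockTriangularSubalgebra`, but no subgroup of `GL`), `Matrix.toSquareBlock`,
`Matrix.blockDiagonal'RingHom`, `Matrix.reindexRingEquiv`, `Equiv.sigmaFiberEquiv`,
`MulEquiv.piUnits`, `Units.map`, `MonoidHom.ker` / `MonoidHom.normal_ker`, `MonoidHom.range`,
`Subgroup.isComplement'_of_disjoint_and_mul_eq_univ`, `Representation.toCoinvariants`,
`Representation.Coinvariants`, `Representation.Equiv`, `IsFiniteLength`,
`Representation.asModule`, `Submodule.quotEquivOfEq`. Mathlib has no unipotent / unitriangular
subgroup of `GL_n` and no parabolic subgroups (grep `unitriangular`, `unipotent`, `parabolic`).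
From H21: `Representation.smoothIndRep`/`SmoothInd` (I5), `Literature.NumberTheory.Automorphic.ParabolicTriple`,
`Representation.jacquetModule`, `Literature.NumberTheory.Automorphic.rootDeltaChar` (I6), `Representation.twist`,
`Representation.IsAdmissible` (G19).

## Design notes

* Generality: the index type `n` is any `Fintype` with `DecidableEq` and the block labels live in
  any `LinearOrder α` (with `Fintype α` where block diagonal matrices are assembled), exactly
  the generality of `Matrix.BlockTriangular`; the outline's `c : Fin n → Fin r` is the model
  case. `IsProperBlocks c` is `Surjective c ∧ Nontrivial α` (`= (2 ≤ r)` for `α = Fin r`,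
  `isProperBlocks_iff_two_le`); it is a hypothesis on `c` (a predicate taking the block labelling
  as an explicit argument, with no instance arguments), not a closed statement: its universal
  closure fails on `Fin 1` (`not_isProperBlocks_of_subsingleton`).
* The two matrix lemmas `Matrix.toSquareBlock_one` and
  `Matrix.BlockTriangular.toSquareBlock_mul` are deliberate dot-notation extensions in
  `namespace Matrix` (they are missing from Mathlib).
* `unipotentRadicalP R c` is an `abbrev` for `(leviProjection R c).ker`, so that the instance
  `MonoidHom.normal_ker` is found by `Representation.toCoinvariants`; consequently `jacquetGL`
  is a one-line definition and is stated over any coefficient ring `k` and any `CommRing R`.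
* `parabolicTripleGL c` is a compatibility object with item I6 only; the `GL_n` functors are
  defined directly and never depend on it (outline I7).
* The analytic definitions (`parabolicIndGL`, `normalizedJacquetGL`) and the theorems are over
  a non-archimedean local field `F` (Mathlib `IsNonarchimedeanLocalField`, via G09
  `Literature.NumberTheory.GaloisRepresentations.LocalField`); `LocallyCompactSpace ↥P_c` (true: `P_c` is closed in the
  locally compact group `GL_n(F)`) is an instance hypothesis, as in I6.

## References

* I. N. Bernstein, A. V. Zelevinsky, *Induced representations of reductive `p`-adic groups I*,
  Ann. Sci. ÉNS 10 (1977), §2.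
* A. V. Zelevinsky, *Induced representations of reductive `p`-adic groups II*, Ann. Sci. ÉNS 13
  (1980), §1.
* W. Casselman, *Introduction to the theory of admissible representations of `p`-adic reductive
  groups* (1995 notes), §3, §6.3.
-/

/-! ### Two matrix lemmas -/

namespace Matrix

variable {n α R : Type*} (b : n → α)

/-- The diagonal blocks of the identity matrix are identity matrices. (Elementary; complements
Mathlib's `Matrix.toBlock_one_self`.) [folklore] -/
@[simp] theorem toSquareBlock_one [DecidableEq n] [Zero R] [One R] (k : α) :
    (1 : Matrix n n R).toSquareBlock b k = 1 :=
  toBlock_one_self _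

variable {b} in
/-- Block triangular matrices multiply blockwise on the diagonal: the `k`-th diagonal block of
`M N` is the product of the `k`-th diagonal blocks. (Bernstein–Zelevinsky 1977, §2.1; the
computation behind "`P → M` is a homomorphism".) [cite: BernsteinZelevinsky1977, §2.1] -/
theorem BlockTriangular.toSquareBlock_mul [Fintype n] [LinearOrder α] [NonUnitalNonAssocSemiring R]
    {M N : Matrix n n R} (hM : M.BlockTriangular b) (hN : N.BlockTriangular b) (k : α) :
    (M * N).toSquareBlock b k = M.toSquareBlock b k * N.toSquareBlock b k := by
  ext i j
  simp only [toSquareBlock_def, of_apply, mul_apply]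
  rw [← Finset.sum_subtype (Finset.univ.filter fun l => b l = k) (by simp)
    (fun l => M i l * N l j)]
  refine (Finset.sum_filter_of_ne fun l _ hl => ?_).symm
  rcases lt_trichotomy (b l) k with h | h | h
  · exact absurd (by rw [hM (h.trans_eq i.2.symm), zero_mul]) hl
  · exact h
  · exact absurd (by rw [hN (j.2.trans_lt h), mul_zero]) hl

end Matrix

namespace Literature.NumberTheory.Automorphic

/-! ### Standard parabolic subgroups of `GL_n` -/

section Algebraic

variable (R : Type*) [CommRing R] {n : Type*} [Fintype n] [DecidableEq n]
  {α : Type*} [LinearOrder α] (c : n → α)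

/-- The **standard parabolic subgroup** `P_c ≤ GL_n(R)` attached to a block labelling
`c : n → α`: invertible matrices which are block upper triangular with respect to `c`
(`g i j = 0` if `c j < c i`, Mathlib `Matrix.BlockTriangular`). Closure under products, `1` and
inverses is Mathlib's `BlockTriangular.mul`, `blockTriangular_one`,
`blockTriangular_inv_of_blockTriangular`.
(Bernstein–Zelevinsky 1977, §2.1; Zelevinsky 1980, §1.1.) [cite: BernsteinZelevinsky1977, §2.1] -/
def standardParabolicGL : Subgroup (GL n R) where
  carrier := {g | (g : Matrix n n R).BlockTriangular c}
  mul_mem' {g h} hg hh := by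
    change ((g * h : GL n R) : Matrix n n R).BlockTriangular c
    rw [Units.val_mul]
    exact hg.mul hh
  one_mem' := by
    change ((1 : GL n R) : Matrix n n R).BlockTriangular c
    rw [Units.val_one]
    exact Matrix.blockTriangular_one
  inv_mem' {g} hg := by
    change ((g⁻¹ : GL n R) : Matrix n n R).BlockTriangular c
    rw [Matrix.coe_units_inv]
    exact Matrix.blockTriangular_inv_of_blockTriangular hg

variable {R} in
/-- Membership in the standard parabolic: `g ∈ P_c ↔ g` is block triangular for `c`. [folklore] -/
@[simp] lemma mem_standardParabolicGL_iff (g : GL n R) :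
    g ∈ standardParabolicGL R c ↔ (g : Matrix n n R).BlockTriangular c := Iff.rfl

variable {R c} in
/-- The underlying matrix of an element of `P_c` is block triangular. [folklore] -/
lemma blockTriangular_of_mem (p : standardParabolicGL R c) :
    ((p : GL n R) : Matrix n n R).BlockTriangular c := p.2

/-- The **Levi projection** `P_c →* Π_a GL_{n_a}(R)`, sending a block triangular matrix to the
family of its diagonal blocks (`Matrix.toSquareBlock`). It is multiplicative because block
triangular matrices multiply blockwise on the diagonal
(`Matrix.BlockTriangular.toSquareBlock_mul`); in particular the diagonal blocks of `p ∈ P_c`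
are invertible with inverses the diagonal blocks of `p⁻¹`.
(Bernstein–Zelevinsky 1977, §2.1; Zelevinsky 1980, §1.1.) [cite: BernsteinZelevinsky1977, §2.1] -/
def leviProjection : standardParabolicGL R c →* Π a, GL {i // c i = a} R where
  toFun p a :=
    { val := ((p : GL n R) : Matrix n n R).toSquareBlock c a
      inv := (((p⁻¹ : standardParabolicGL R c) : GL n R) : Matrix n n R).toSquareBlock c a
      val_inv := by
        rw [← (blockTriangular_of_mem p).toSquareBlock_mul (blockTriangular_of_mem p⁻¹),
          Subgroup.coe_inv, Units.mul_inv, Matrix.toSquareBlock_one]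
      inv_val := by
        rw [← (blockTriangular_of_mem p⁻¹).toSquareBlock_mul (blockTriangular_of_mem p),
          Subgroup.coe_inv, Units.inv_mul, Matrix.toSquareBlock_one] }
  map_one' := by
    funext a
    ext1
    change (((1 : standardParabolicGL R c) : GL n R) : Matrix n n R).toSquareBlock c a = 1
    rw [Subgroup.coe_one, Units.val_one, Matrix.toSquareBlock_one]
  map_mul' p q := by
    funext a
    ext1
    change (((p * q : standardParabolicGL R c) : GL n R) : Matrix n n R).toSquareBlock c a =
      ((p : GL n R) : Matrix n n R).toSquareBlock c a *
        ((q : GL n R) : Matrix n n R).toSquareBlock c a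
    rw [Subgroup.coe_mul, Units.val_mul]
    exact (blockTriangular_of_mem p).toSquareBlock_mul (blockTriangular_of_mem q) a

variable {R} in
/-- The `a`-th component of the Levi projection is the `a`-th diagonal block. [folklore] -/
@[simp] lemma coe_leviProjection_apply (p : standardParabolicGL R c) (a : α) :
    ((leviProjection R c p a : GL {i // c i = a} R) : Matrix _ _ R) =
      ((p : GL n R) : Matrix n n R).toSquareBlock c a := rfl

variable {R} in
/-- Entries of the Levi projection: `(leviProjection R c p a) i j = p i j`. [folklore] -/
@[simp] lemma leviProjection_apply_coe (p : standardParabolicGL R c) (a : α)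
    (i j : {i // c i = a}) :
    ((leviProjection R c p a : GL {i // c i = a} R) : Matrix _ _ R) i j =
      ((p : GL n R) : Matrix n n R) i j := rfl

/-- The block diagonal matrix in `GL_n(R)` with diagonal blocks `m a ∈ GL_{n_a}(R)`:
`Matrix.blockDiagonal'RingHom` reindexed along
`Equiv.sigmaFiberEquiv c : (Σ a, {i // c i = a}) ≃ n` (`Matrix.reindexRingEquiv`), on units
(`Units.map`, `MulEquiv.piUnits`).
(Bernstein–Zelevinsky 1977, §2.1.) [cite: BernsteinZelevinsky1977, §2.1] -/
def blockDiagonalGL [Fintype α] : (Π a, GL {i // c i = a} R) →* GL n R :=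
  (Units.map
    (((Matrix.reindexRingEquiv R (Equiv.sigmaFiberEquiv c)).toRingHom.comp
      (Matrix.blockDiagonal'RingHom (fun a => {i // c i = a}) R)).toMonoidHom)).comp
    (MulEquiv.piUnits (M := fun a => Matrix {i // c i = a} {i // c i = a} R)).symm.toMonoidHom

variable {R} in
/-- Entries of the block diagonal matrix:
`blockDiagonalGL R c m i j = blockDiagonal' m ⟨c i, i⟩ ⟨c j, j⟩` (so it is `(m (c i)) i j` if
`c i = c j` and `0` otherwise, `Matrix.blockDiagonal'_apply_eq`/`_apply_ne`). [folklore] -/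
lemma blockDiagonalGL_apply_coe [Fintype α] (m : Π a, GL {i // c i = a} R) (i j : n) :
    ((blockDiagonalGL R c m : GL n R) : Matrix n n R) i j =
      Matrix.blockDiagonal'
        (fun a => (Units.val (m a) : Matrix {k // c k = a} {k // c k = a} R))
        (⟨c i, ⟨i, rfl⟩⟩ : Σ a, {k // c k = a}) (⟨c j, ⟨j, rfl⟩⟩ : Σ a, {k // c k = a}) :=
  rfl

variable {R} in
/-- A block diagonal matrix is block triangular. [folklore] -/
lemma blockDiagonalGL_mem [Fintype α] (m : Π a, GL {i // c i = a} R) :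
    blockDiagonalGL R c m ∈ standardParabolicGL R c := by
  intro i j hij
  rw [blockDiagonalGL_apply_coe, Matrix.blockDiagonal'_apply_ne _ _ _ hij.ne']

/-- The **Levi embedding into `P_c`**: `Π_a GL_{n_a}(R) →* P_c`, `m ↦ diag(m_a)_a`
(`blockDiagonalGL` with its range restricted). (Bernstein–Zelevinsky 1977, §2.1.) [cite: BernsteinZelevinsky1977, §2.1] -/
def leviEmbeddingP [Fintype α] : (Π a, GL {i // c i = a} R) →* standardParabolicGL R c :=
  (blockDiagonalGL R c).codRestrict _ (blockDiagonalGL_mem c)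

/-- The **Levi embedding** `Π_a GL_{n_a}(R) →* GL_n(R)` (block diagonal matrices), the composite
of `leviEmbeddingP` with the inclusion `P_c ≤ GL_n(R)`. (Bernstein–Zelevinsky 1977, §2.1.) [cite: BernsteinZelevinsky1977, §2.1] -/
def leviEmbedding [Fintype α] : (Π a, GL {i // c i = a} R) →* GL n R :=
  (standardParabolicGL R c).subtype.comp (leviEmbeddingP R c)

variable {R} in
/-- `leviEmbedding R c = blockDiagonalGL R c` (unfolding lemma). [folklore] -/
@[simp] lemma leviEmbedding_apply [Fintype α] (m : Π a, GL {i // c i = a} R) :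
    leviEmbedding R c m = blockDiagonalGL R c m := rfl

variable {R} in
/-- `(leviEmbeddingP R c m : GL n R) = blockDiagonalGL R c m` (unfolding lemma). [folklore] -/
@[simp] lemma coe_leviEmbeddingP [Fintype α] (m : Π a, GL {i // c i = a} R) :
    (leviEmbeddingP R c m : GL n R) = blockDiagonalGL R c m := rfl

/-- **Section identity**: the diagonal blocks of `diag(m_a)_a` are the `m_a`, i.e.
`leviProjection ∘ leviEmbeddingP = id`. (Bernstein–Zelevinsky 1977, §2.1.) [cite: BernsteinZelevinsky1977, §2.1] -/
theorem leviProjection_leviEmbeddingP [Fintype α] :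
    (leviProjection R c).comp (leviEmbeddingP R c) = MonoidHom.id _ := by
  ext m a i j
  obtain ⟨i, hi⟩ := i
  obtain ⟨j, hj⟩ := j
  subst hi
  change Matrix.blockDiagonal' (fun a => (Units.val (m a) : Matrix {k // c k = a} {k // c k = a} R))
      (⟨c i, ⟨i, rfl⟩⟩ : Σ a, {k // c k = a}) (⟨c j, ⟨j, rfl⟩⟩ : Σ a, {k // c k = a}) =
    (Units.val (m (c i))) ⟨i, rfl⟩ ⟨j, hj⟩
  have : (⟨c j, ⟨j, rfl⟩⟩ : Σ a, {k // c k = a}) = ⟨c i, ⟨j, hj⟩⟩ := Sigma.subtype_ext hj rfl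
  rw [this, Matrix.blockDiagonal'_apply_eq]

variable {R} in
/-- Pointwise section identity: `leviProjection R c (leviEmbeddingP R c m) = m`. [folklore] -/
@[simp] lemma leviProjection_leviEmbeddingP_apply [Fintype α] (m : Π a, GL {i // c i = a} R) :
    leviProjection R c (leviEmbeddingP R c m) = m :=
  DFunLike.congr_fun (leviProjection_leviEmbeddingP R c) m

/-! ### Unipotent radical and Levi subgroup -/

/-- The **unipotent radical of `P_c` as a subgroup of `P_c`**: the kernel of the Levi projection
(block triangular matrices with identity diagonal blocks). It is normal in `P_c` by Mathlib's
instance `MonoidHom.normal_ker` (this is an `abbrev` so that the instance is found).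
(Bernstein–Zelevinsky 1977, §2.1; Zelevinsky 1980, §1.1.) [cite: BernsteinZelevinsky1977, §2.1] -/
abbrev unipotentRadicalP : Subgroup (standardParabolicGL R c) := (leviProjection R c).ker

/-- The **unipotent radical** `U_c ≤ GL_n(R)` of the standard parabolic `P_c`: the image of
`unipotentRadicalP R c` in `GL_n(R)`. (Bernstein–Zelevinsky 1977, §2.1; Zelevinsky 1980, §1.1.) [cite: BernsteinZelevinsky1977, §2.1] -/
def unipotentRadicalGL : Subgroup (GL n R) :=
  (unipotentRadicalP R c).map (standardParabolicGL R c).subtype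

/-- `U_c ≤ P_c`. [folklore] -/
lemma unipotentRadicalGL_le : unipotentRadicalGL R c ≤ standardParabolicGL R c :=
  Subgroup.map_subtype_le _

/-- `U_c`, pulled back to `P_c`, is the kernel of the Levi projection. [folklore] -/
lemma unipotentRadicalGL_subgroupOf :
    (unipotentRadicalGL R c).subgroupOf (standardParabolicGL R c) = unipotentRadicalP R c :=
  Subgroup.comap_map_eq_self_of_injective (standardParabolicGL R c).subtype_injective _

variable {R} in
/-- Membership in the unipotent radical: `g ∈ U_c` iff `g` is block triangular with identity
diagonal blocks. (Bernstein–Zelevinsky 1977, §2.1.) [cite: BernsteinZelevinsky1977, §2.1] -/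
theorem mem_unipotentRadicalGL_iff (g : GL n R) :
    g ∈ unipotentRadicalGL R c ↔ (g : Matrix n n R).BlockTriangular c ∧
      ∀ a, (g : Matrix n n R).toSquareBlock c a = 1 := by
  constructor
  · rintro ⟨p, hp, rfl⟩
    refine ⟨blockTriangular_of_mem p, fun a => ?_⟩
    have h := congrArg (fun m : Π a, GL {i // c i = a} R => Units.val (m a))
      (MonoidHom.mem_ker.1 hp)
    simpa using h
  · rintro ⟨hg, h1⟩
    refine ⟨⟨g, hg⟩, MonoidHom.mem_ker.2 ?_, rfl⟩
    funext a
    ext1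
    rw [coe_leviProjection_apply]
    exact h1 a

/-- The **standard Levi subgroup** `M_c ≤ GL_n(R)`: block diagonal invertible matrices, the range
of the Levi embedding. (Bernstein–Zelevinsky 1977, §2.1; Zelevinsky 1980, §1.1.) [cite: BernsteinZelevinsky1977, §2.1] -/
def standardLeviGL [Fintype α] : Subgroup (GL n R) := (leviEmbedding R c).range

/-- `M_c ≤ P_c`. [folklore] -/
lemma standardLeviGL_le [Fintype α] : standardLeviGL R c ≤ standardParabolicGL R c := by
  rintro _ ⟨m, rfl⟩
  exact (leviEmbeddingP R c m).2

/-- The block labelling `c : n → α` defines a **proper** standard parabolic subgroup of `GL_n`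
(`P_c ≠ GL_n`, all blocks non-empty): `c` is surjective (every block `{i // c i = a}` is
non-empty) and there are at least two blocks (`α` nontrivial). In Bernstein–Zelevinsky's
language: the standard subgroups `M` of `G = GL(n, F)` are numbered by the ordered partitions
`(n₁, …, n_r)` of `n` (§2.2), and the *proper* ones, `M ≠ G` (those over which quasicuspidality is
tested, §2.4), are the partitions with `r ≥ 2` parts. This is a **predicate** on block labellings
(the hypothesis of statements about proper parabolics and their Jacquet modules, e.g.
`isSupercuspidal_iff_jacquetGL`), with the labelling as an explicit argument and no instance
arguments; it is not a closed statement — it fails for `c = id : Fin 1 → Fin 1`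
(`not_isProperBlocks_of_subsingleton`) — and it is characterised group-theoretically by
`isProperBlocks_iff_ne_top`. (Bernstein–Zelevinsky 1977, §2.2 and §2.4, p. 446.) [cite: BernsteinZelevinsky1977, §2.2 and §2.4] -/
def IsProperBlocks (c : n → α) : Prop := Function.Surjective c ∧ Nontrivial α

/-- For `c : Fin m → Fin r`, `IsProperBlocks c ↔ c` surjective and `2 ≤ r`. [folklore] -/
lemma isProperBlocks_iff_two_le {m r : ℕ} (c : Fin m → Fin r) :
    IsProperBlocks c ↔ Function.Surjective c ∧ 2 ≤ r := by
  rw [IsProperBlocks, Fin.nontrivial_iff_two_le]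

/-! ### The parabolic triple `(P_c, M_c, U_c)` -/

/-- The **standard parabolic triple** `(P_c, M_c, U_c)` of `GL_n(R)` as an abstract
`Literature.NumberTheory.Automorphic.ParabolicTriple` (item I6): `P_c` normalises `U_c` because `U_c` is the kernel of the Levi
projection, and `P_c = M_c ⋉ U_c` (`Subgroup.isComplement'_of_disjoint_and_mul_eq_univ`) by the
section identity `leviProjection ∘ leviEmbeddingP = id`: `p = ℓ(p) · (ℓ(p)⁻¹ p)` with
`ℓ = leviEmbeddingP ∘ leviProjection`. This is a compatibility object only; the `GL_n` functors
below are defined directly. (Bernstein–Zelevinsky 1977, §2.1; Zelevinsky 1980, §1.1.) [cite: BernsteinZelevinsky1977, §2.1] -/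
def parabolicTripleGL [Fintype α] : ParabolicTriple (GL n R) where
  P := standardParabolicGL R c
  M := standardLeviGL R c
  N := unipotentRadicalGL R c
  M_le := standardLeviGL_le R c
  N_le := unipotentRadicalGL_le R c
  le_normalizer :=
    (Subgroup.normal_subgroupOf_iff_le_normalizer (unipotentRadicalGL_le R c)).1
      (by rw [unipotentRadicalGL_subgroupOf]; infer_instance)
  isComplement' := by
    refine Subgroup.isComplement'_of_disjoint_and_mul_eq_univ ?_ ?_
    · rw [Subgroup.disjoint_def]
      rintro p ⟨m, hm⟩ hp
      have hpm : p = leviEmbeddingP R c m := Subtype.ext hm.symm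
      have hp' : p ∈ unipotentRadicalP R c := by rwa [← unipotentRadicalGL_subgroupOf]
      rw [MonoidHom.mem_ker, hpm, leviProjection_leviEmbeddingP_apply] at hp'
      rw [hpm, hp', map_one]
    · refine Set.eq_univ_of_forall fun p => Set.mem_mul.2
        ⟨leviEmbeddingP R c (leviProjection R c p), Subgroup.mem_subgroupOf.2 ⟨_, rfl⟩,
          (leviEmbeddingP R c (leviProjection R c p))⁻¹ * p, ?_, mul_inv_cancel_left _ _⟩
      have : (leviEmbeddingP R c (leviProjection R c p))⁻¹ * p ∈ unipotentRadicalP R c := by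
        rw [MonoidHom.mem_ker, map_mul, map_inv, leviProjection_leviEmbeddingP_apply,
          inv_mul_cancel]
      rwa [← unipotentRadicalGL_subgroupOf] at this

/-- The parabolic of `parabolicTripleGL R c` is `P_c` (`rfl`). [folklore] -/
@[simp] lemma parabolicTripleGL_P [Fintype α] :
    (parabolicTripleGL R c).P = standardParabolicGL R c :=
  rfl

/-- The Levi of `parabolicTripleGL R c` is `M_c` (`rfl`). [folklore] -/
@[simp] lemma parabolicTripleGL_M [Fintype α] : (parabolicTripleGL R c).M = standardLeviGL R c :=
  rfl

/-- The radical of `parabolicTripleGL R c` is `U_c` (`rfl`). [folklore] -/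
@[simp] lemma parabolicTripleGL_N [Fintype α] :
    (parabolicTripleGL R c).N = unipotentRadicalGL R c :=
  rfl

end Algebraic

/-! ### Proper block labellings -/

section ProperBlocks

variable {n α : Type*}

/-- Every block of a proper block labelling is non-empty. [folklore] -/
lemma IsProperBlocks.nonempty_fiber {c : n → α} (h : IsProperBlocks c) (a : α) :
    Nonempty {i // c i = a} :=
  let ⟨i, hi⟩ := h.1 a
  ⟨⟨i, hi⟩⟩

/-- A proper block labelling needs at least two indices (`Function.Surjective.nontrivial`).
[folklore] -/
lemma IsProperBlocks.nontrivial {c : n → α} (h : IsProperBlocks c) : Nontrivial n :=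
  haveI := h.2
  h.1.nontrivial

/-- There is no proper block labelling on at most one index (no proper standard parabolic in
`GL_0`, `GL_1`); in particular `IsProperBlocks` is a genuine hypothesis on `c` — it fails for
`c = id : Fin 1 → Fin 1` — and not a theorem. [folklore] -/
lemma not_isProperBlocks_of_subsingleton [Subsingleton n] (c : n → α) : ¬ IsProperBlocks c :=
  fun h => not_nontrivial n h.nontrivial

/-- A proper block labelling with labels in a linear order has indices `i j` with `c j < c i`,
i.e. an entry position strictly below the block diagonal. [folklore] -/
lemma IsProperBlocks.exists_lt [LinearOrder α] {c : n → α} (h : IsProperBlocks c) :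
    ∃ i j : n, c j < c i := by
  obtain ⟨hs, hα⟩ := h
  obtain ⟨a, b, hab⟩ := hα.exists_pair_ne
  rcases Ne.lt_or_gt hab with hlt | hlt
  · obtain ⟨i, rfl⟩ := hs b
    obtain ⟨j, rfl⟩ := hs a
    exact ⟨i, j, hlt⟩
  · obtain ⟨i, rfl⟩ := hs a
    obtain ⟨j, rfl⟩ := hs b
    exact ⟨i, j, hlt⟩

variable (R : Type*) [CommRing R] [Fintype n] [DecidableEq n] [LinearOrder α] (c : n → α)

/-- With at most one block label every invertible matrix is block triangular: `P_c = GL_n(R)`.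
[folklore] -/
lemma standardParabolicGL_eq_top_of_subsingleton [Subsingleton α] :
    standardParabolicGL R c = ⊤ :=
  (Subgroup.eq_top_iff' _).2 fun g => (mem_standardParabolicGL_iff c g).2
    fun i j hij => absurd (Subsingleton.elim (c j) (c i)) hij.ne

variable {R c} in
/-- If `c j < c i` for some indices `i, j`, the elementary matrix `1 + E_{ij} ∈ GL_n(R)`
(Mathlib `Matrix.transvection i j 1`, with inverse `1 - E_{ij}`) has the entry `1 ≠ 0` at the
position `(i, j)` strictly below the block diagonal, so it is not in `P_c`: hence
`P_c ≠ GL_n(R)` over a nontrivial ring. [folklore] -/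
lemma standardParabolicGL_ne_top_of_lt [Nontrivial R] {i j : n} (hij : c j < c i) :
    standardParabolicGL R c ≠ ⊤ := by
  have hne : i ≠ j := fun e => hij.ne' (congrArg c e)
  intro htop
  let g : GL n R :=
    ⟨Matrix.transvection i j 1, Matrix.transvection i j (-1),
      by rw [Matrix.transvection_mul_transvection_same i j hne, add_neg_cancel,
        Matrix.transvection_zero],
      by rw [Matrix.transvection_mul_transvection_same i j hne, neg_add_cancel,
        Matrix.transvection_zero]⟩
  have hg : g ∈ standardParabolicGL R c := by
    rw [htop]
    exact Subgroup.mem_top g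
  have h0 : (g : Matrix n n R) i j = 0 := (mem_standardParabolicGL_iff c g).1 hg hij
  have h1 : (g : Matrix n n R) i j = 1 := by
    change Matrix.transvection i j (1 : R) i j = 1
    simp [Matrix.transvection, hne]
  exact one_ne_zero (h1.symm.trans h0)

variable {c} in
/-- A proper block labelling defines a proper parabolic: `P_c ≠ GL_n(R)` (`R` nontrivial).
[folklore] -/
lemma IsProperBlocks.standardParabolicGL_ne_top [Nontrivial R] (h : IsProperBlocks c) :
    standardParabolicGL R c ≠ ⊤ := by
  obtain ⟨i, j, hij⟩ := h.exists_lt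
  exact standardParabolicGL_ne_top_of_lt hij

/-- **Proper block labellings are exactly the proper standard parabolics with non-empty blocks.**
Over a nontrivial commutative ring `R`, `IsProperBlocks c` holds iff the standard parabolic `P_c`
is a proper subgroup of `GL_n(R)` and every block `{i // c i = a}` is non-empty — the formal
content of the gloss "`P_c ≠ GL_n`, all blocks non-empty" in the docstring of `IsProperBlocks`
(a standard subgroup `M ≠ G` of `GL_n` attached to an ordered partition of `n`,
Bernstein–Zelevinsky 1977, §2.2 and §2.4). (`→`: a transvection below the block diagonal,
`standardParabolicGL_ne_top_of_lt`; `←`: with one label every matrix is block triangular,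
`standardParabolicGL_eq_top_of_subsingleton`.) [folklore] -/
theorem isProperBlocks_iff_ne_top [Nontrivial R] :
    IsProperBlocks c ↔ standardParabolicGL R c ≠ ⊤ ∧ ∀ a, Nonempty {i // c i = a} := by
  refine ⟨fun h => ⟨h.standardParabolicGL_ne_top R, h.nonempty_fiber⟩, fun ⟨hP, hne⟩ => ⟨?_, ?_⟩⟩
  · intro a
    obtain ⟨⟨i, hi⟩⟩ := hne a
    exact ⟨i, hi⟩
  · by_contra hα
    rw [not_nontrivial_iff_subsingleton] at hα
    exact hP (standardParabolicGL_eq_top_of_subsingleton R c)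

end ProperBlocks

/-- The **upper unitriangular subgroup** `U_n ≤ GL_n(R)`: upper triangular invertible matrices
with `1`'s on the diagonal, the unipotent radical of the Borel `P_id` (`c = id`).
(Bernstein–Zelevinsky 1977, §2.1; used for Whittaker models, item I17.) [cite: BernsteinZelevinsky1977, §2.1] -/
def upperUnitriangular (n : Type*) [Fintype n] [LinearOrder n] (R : Type*)
    [CommRing R] : Subgroup (GL n R) :=
  unipotentRadicalGL (R := R) (id : n → n)

/-- Membership in `U_n`: `g` is upper triangular with unit diagonal. [folklore] -/
theorem mem_upperUnitriangular_iff {n : Type*} [Fintype n] [LinearOrder n]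
    {R : Type*} [CommRing R] (g : GL n R) :
    g ∈ upperUnitriangular n R ↔
      (g : Matrix n n R).BlockTriangular id ∧ ∀ i, (g : Matrix n n R) i i = 1 := by
  rw [upperUnitriangular, mem_unipotentRadicalGL_iff]
  refine and_congr_right fun _ => ⟨fun h i => ?_, fun h a => ?_⟩
  · have := congrFun (congrFun (h i) ⟨i, rfl⟩) ⟨i, rfl⟩
    rwa [Matrix.one_apply_eq] at this
  · ext ⟨i, hi⟩ ⟨j, hj⟩
    obtain rfl : i = a := hi
    obtain rfl : j = i := hj
    rw [Matrix.one_apply_eq]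
    exact h _

end Literature.NumberTheory.Automorphic

/-! ### Parabolic induction and Jacquet functors on `GL_n` -/

namespace Representation

open Literature.NumberTheory.Automorphic

section JacquetGL

variable {k : Type*} [CommRing k] (R : Type*) [CommRing R] {n : Type*} [Fintype n]
  [DecidableEq n] {α : Type*} [LinearOrder α] [Fintype α] (c : n → α)
  {V : Type*} [AddCommGroup V] [Module k V]

/-- The restriction `π|_{U_c}` of a representation `π` of `GL_n(R)` to the unipotent radical
`unipotentRadicalP R c ≤ P_c` (an `abbrev`; its coinvariants carry the Jacquet module
`jacquetGL`). (Bernstein–Zelevinsky 1977, §2.3.) [cite: BernsteinZelevinsky1977, §2.3] -/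
abbrev restrictUnipotentGL (π : Representation k (GL n R) V) :
    Representation k (unipotentRadicalP R c) V :=
  (π.comp (standardParabolicGL R c).subtype).comp (unipotentRadicalP R c).subtype

/-- The (unnormalised) **Jacquet functor of `GL_n`** for the standard parabolic `P_c`:
`r_c π = π_{U_c}`, the `U_c`-coinvariants of `π` (Mathlib `Representation.toCoinvariants` for the
normal subgroup `unipotentRadicalP R c = ker (leviProjection R c)` of `P_c`), with
`Π_a GL_{n_a}(R)` acting through the Levi embedding `leviEmbeddingP`. No group-theoretic proof
is needed: normality is Mathlib's `MonoidHom.normal_ker`.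
(Bernstein–Zelevinsky 1977, §2.3; Zelevinsky 1980, §1.1.) [cite: BernsteinZelevinsky1977, §2.3] -/
noncomputable def jacquetGL (π : Representation k (GL n R) V) :
    Representation k (Π a, GL {i // c i = a} R) (restrictUnipotentGL R c π).Coinvariants :=
  (Representation.toCoinvariants (π.comp (standardParabolicGL R c).subtype)
    (unipotentRadicalP R c)).comp (leviEmbeddingP R c)

/-- The action on the `GL_n` Jacquet module: `m • [v] = [π (diag m) v]`. [folklore] -/
@[simp] lemma jacquetGL_mk (π : Representation k (GL n R) V) (m : Π a, GL {i // c i = a} R)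
    (v : V) :
    jacquetGL R c π m (Coinvariants.mk (restrictUnipotentGL R c π) v) =
      Coinvariants.mk (restrictUnipotentGL R c π) (π (blockDiagonalGL R c m) v) :=
  rfl

/-- **Compatibility with the abstract Jacquet module** (item I6), as data: the isomorphism
between `jacquetGL R c π` and the `M_c`-representation `π.jacquetModule (parabolicTripleGL R c)`
transported along `leviEmbedding : Π_a GL_{n_a}(R) → M_c`. Both carriers are
`V / ⟨π(u) v - v : u ∈ U_c⟩` (the two kernels agree by `unipotentRadicalGL_subgroupOf`, whence
`Submodule.quotEquivOfEq`) and `m` acts on both by `[v] ↦ [π (diag m) v]`.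
(Bernstein–Zelevinsky 1977, §2.3.) [cite: BernsteinZelevinsky1977, §2.3] -/
noncomputable def jacquetGLEquiv (π : Representation k (GL n R) V) :
    (jacquetGL R c π).Equiv
      ((π.jacquetModule (parabolicTripleGL R c)).comp (leviEmbedding R c).rangeRestrict) :=
  have hker : Coinvariants.ker (restrictUnipotentGL R c π) =
      Coinvariants.ker ((parabolicTripleGL R c).restrict π) := by
    change _ = Coinvariants.ker ((π.comp (standardParabolicGL R c).subtype).comp
      ((unipotentRadicalGL R c).subgroupOf (standardParabolicGL R c)).subtype)
    rw [unipotentRadicalGL_subgroupOf]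
  Representation.Equiv.mk (Submodule.quotEquivOfEq _ _ hker) fun _ =>
    Coinvariants.hom_ext (LinearMap.ext fun _ => rfl)

/-- `jacquetGLEquiv` is the identity on representatives: `[v] ↦ [v]`. [folklore] -/
@[simp] lemma jacquetGLEquiv_mk (π : Representation k (GL n R) V) (v : V) :
    jacquetGLEquiv R c π (Coinvariants.mk (restrictUnipotentGL R c π) v) =
      Coinvariants.mk ((parabolicTripleGL R c).restrict π) v :=
  rfl

/-- **Compatibility with the abstract Jacquet module** (item I6): `jacquetGL R c π` is
isomorphic to `π.jacquetModule (parabolicTripleGL R c)` transported along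
`leviEmbedding : Π_a GL_{n_a}(R) → M_c` (witnessed by `jacquetGLEquiv`).
(Bernstein–Zelevinsky 1977, §2.3.) [cite: BernsteinZelevinsky1977, §2.3] -/
theorem jacquetGL_equiv_jacquetModule (π : Representation k (GL n R) V) :
    Nonempty ((jacquetGL R c π).Equiv
      ((π.jacquetModule (parabolicTripleGL R c)).comp (leviEmbedding R c).rangeRestrict)) :=
  ⟨jacquetGLEquiv R c π⟩

end JacquetGL

section LocalField

variable (F : Type*) [Field F] [ValuativeRel F] [TopologicalSpace F] [IsNonarchimedeanLocalField F]
  {n : Type*} [Fintype n] [DecidableEq n] {α : Type*} [LinearOrder α] [Fintype α] (c : n → α)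

/-- **Normalised parabolic induction on `GL_n(F)`**, `F` a non-archimedean local field:
`i_c σ = Ind_{P_c}^{GL_n} (σ ∘ leviProjection ⊗ δ_{P_c}^{1/2})` for a representation `σ` of
`Π_a GL_{n_a}(F)` (H21 `smoothIndRep`, `Representation.twist`, `rootDeltaChar`).
`LocallyCompactSpace ↥P_c` holds since `P_c` is closed in `GL_n(F)`; it is an instance
hypothesis. (Bernstein–Zelevinsky 1977, §2.3; Zelevinsky 1980, §1.1.) [cite: BernsteinZelevinsky1977, §2.3] -/
noncomputable def parabolicIndGL [LocallyCompactSpace (standardParabolicGL F c)]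
    {W : Type*} [AddCommGroup W] [Module ℂ W] (σ : Representation ℂ (Π a, GL {i // c i = a} F) W) :
    Representation ℂ (GL n F) (SmoothInd (standardParabolicGL F c)
      (Representation.twist (σ.comp (leviProjection F c))
        (rootDeltaChar (standardParabolicGL F c)))) :=
  smoothIndRep (standardParabolicGL F c)
    (Representation.twist (σ.comp (leviProjection F c)) (rootDeltaChar (standardParabolicGL F c)))

/-- The **normalised Jacquet functor on `GL_n(F)`**: `r_c π = π_{U_c} ⊗ δ_{P_c}^{-1/2}`, the twist
of `jacquetGL F c π` by `(δ_{P_c}^{1/2})⁻¹ ∘ leviEmbeddingP`; left adjoint to `parabolicIndGL`.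
(Bernstein–Zelevinsky 1977, §2.3; Zelevinsky 1980, §1.1.) [cite: BernsteinZelevinsky1977, §2.3] -/
noncomputable def normalizedJacquetGL [LocallyCompactSpace (standardParabolicGL F c)]
    {V : Type*} [AddCommGroup V] [Module ℂ V] (π : Representation ℂ (GL n F) V) :
    Representation ℂ (Π a, GL {i // c i = a} F) (restrictUnipotentGL F c π).Coinvariants :=
  (jacquetGL F c π).twist ((rootDeltaChar (standardParabolicGL F c))⁻¹.comp (leviEmbeddingP F c))

/-- Unfolding lemma: `normalizedJacquetGL F c π m [v] = δ_{P_c}(diag m)^{-1/2} • [π (diag m) v]`. [folklore] -/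
@[simp] lemma normalizedJacquetGL_mk [LocallyCompactSpace (standardParabolicGL F c)]
    {V : Type*} [AddCommGroup V] [Module ℂ V] (π : Representation ℂ (GL n F) V)
    (m : Π a, GL {i // c i = a} F) (v : V) :
    normalizedJacquetGL F c π m (Coinvariants.mk (restrictUnipotentGL F c π) v) =
      (((rootDeltaChar (standardParabolicGL F c) (leviEmbeddingP F c m))⁻¹ : ℂˣ) : ℂ) •
        Coinvariants.mk (restrictUnipotentGL F c π) (π (blockDiagonalGL F c m) v) :=
  rfl

/-- **Parabolic induction preserves admissibility** on `GL_n(F)`: if `σ` is an admissible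
representation of `Π_a GL_{n_a}(F)` then `i_c σ` is admissible (`P_c \ GL_n(F)` is compact).
(Bernstein–Zelevinsky 1977, Prop. 2.3; Zelevinsky 1980, Prop. 1.1; Casselman 1995, §3.) [cite: BernsteinZelevinsky1977, Prop. 2.3] -/
def isAdmissible_parabolicIndGL : Prop :=
  ∀ [LocallyCompactSpace (standardParabolicGL F c)] {W : Type*} [AddCommGroup W] [Module ℂ W] (σ : Representation ℂ (Π a, GL {i // c i = a} F) W) (hσ : σ.IsAdmissible),
    (parabolicIndGL F c σ).IsAdmissible

/-- **Parabolic induction preserves finite length** on `GL_n(F)`: if `σ` is an admissible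
representation of `Π_a GL_{n_a}(F)` of finite length (as a module over the group algebra), then
`i_c σ` has finite length as a `ℂ[GL_n(F)]`-module.
(Bernstein–Zelevinsky 1977, §2.3 and Thm. 2.8 ff.; Zelevinsky 1980, Prop. 1.1; review 10.) [cite: BernsteinZelevinsky1977, §2.3 and Thm. 2.8 ff] -/
def isFiniteLength_parabolicIndGL : Prop :=
  ∀ [LocallyCompactSpace (standardParabolicGL F c)] {W : Type*} [AddCommGroup W] [Module ℂ W] (σ : Representation ℂ (Π a, GL {i // c i = a} F) W) (hσ : σ.IsAdmissible) (hσ' : IsFiniteLength (MonoidAlgebra ℂ (Π a, GL {i // c i = a} F)) σ.asModule),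
    IsFiniteLength (MonoidAlgebra ℂ (GL n F)) (parabolicIndGL F c σ).asModule

end LocalField

section JacquetLemmaGL

/-- **Jacquet's lemma for `GL_n(F)`** (named fact). Let `F` be a non-archimedean local field and
`P_c = M_c U_c ≤ GL_n(F)` the standard parabolic subgroup of a block labelling `c` (any finite
index type `n`, labels in a finite linear order). Then the Jacquet functor `r_c` — the
`U_c`-coinvariants `Representation.jacquetGL F c π` with the action of
`Π_a GL_{n_a}(F) ≅ M_c` — carries admissible representations of `GL_n(F)` to admissible
representations of `Π_a GL_{n_a}(F)`. Source: Bernstein–Zelevinsky 1977, §2.3, Proposition,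
part (e), p. 446, for a reductive `F`-group `G` and a standard subgroup `M < G` (for
`G = GL(n, F)` these are the block diagonal `G_β`, §2.2): "The functors `i_{G,M}` and `r_{M,G}`
carry admissible representations into admissible ones. … It was proved by Jacquet that
`r_{M,G}` carries admissible representations into admissible ones (see [7] and [1] for the case
`G = GL(n, F)`)"; there `r_{M,G}` is the Jacquet functor normalised by `mod^{1/2}` (§1.8), a
twist by a character of `M` trivial on every compact subgroup, which does not affect
admissibility. Also Casselman 1995, Thm. 3.3.1 (any parabolic of a reductive `p`-adic group,
unnormalised `V_N`); Zelevinsky 1980, Prop. 1.1.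

Statement repair (2026-08-15). The earlier form of this constant had the same body but took its
hypotheses on `F` from the anonymous instance variables of `section LocalField`; since a `def`
absorbs only the section variables its body uses, `[ValuativeRel F] [IsNonarchimedeanLocalField F]`
were silently dropped and the constant quantified over a field `F` with an *arbitrary* topology
(`#check` showed `(F : Type _) → [Field F] → [TopologicalSpace F] → … → (n → α) → Prop`). That
statement is not the cited theorem and is false: topologise `F = ℚ` by "`U` is open iff `0 ∉ U`
or `U = univ`"; then a neighbourhood of `1` in `GL_2(F)` only constrains the diagonal entries of
`g` and `g⁻¹`, so every open subgroup contains all elementary unipotent matrices, hence every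
`diag(a, a⁻¹)`, and is not compact (on the closed set of diagonal matrices the entry `g₀₀` would
have compact, i.e. finite, image avoiding `0`); so `GL_2(F)` has no compact open subgroup and the
trivial representation on `ℂ^(ℕ)` is admissible, whereas `{1}` is compact open in the Levi
`F^× × F^×` (discrete) and `V_N = ℂ^(ℕ)` is not finite-dimensional. Here every hypothesis is an
explicit binder of the definition itself, so none can be dropped (the same repair as
`Representation.isAdmissible_jacquetModule_of_charZero` in
`Literature.NumberTheory.Automorphic.JacquetLemma`). No declaration used the old constant.

Proof route (not yet formalised): the abstract Jacquet lemma
`Representation.IsAdmissible.jacquetModule` (file `JacquetLemma`, proved from an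
`IwahoriDatum`) for `parabolicTripleGL F c`, with the datum given by the principal congruence
subgroups `1 + ϖ^{m+1} M_n(𝒪_F)` (Iwahori factorisation with respect to `(U_c⁻, M_c, U_c)` and the
contracting block-scalar element `diag(ϖ^{e(c i)})`, `e` antitone), transported along
`jacquetGLEquiv` and the topological isomorphism `leviEmbedding : Π_a GL_{n_a}(F) ≃ M_c`
(Bernstein–Zelevinsky 1976, §3; Casselman 1995, Prop. 1.4.4 and §3.3).
[cite: BernsteinZelevinsky1977, §2.3 Proposition (e), p. 446] -/
def isAdmissible_jacquetGL (F : Type*) [Field F] [ValuativeRel F] [TopologicalSpace F]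
    [IsNonarchimedeanLocalField F] {n : Type*} [Fintype n] [DecidableEq n] {α : Type*}
    [LinearOrder α] [Fintype α] (c : n → α) : Prop :=
  ∀ {V : Type*} [AddCommGroup V] [Module ℂ V] (π : Representation ℂ (GL n F) V),
    π.IsAdmissible → (jacquetGL F c π).IsAdmissible

end JacquetLemmaGL

end Representation
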